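import Mathlib
import Literature.Analysis.FluidPDE.SuitableWeakStability
import HarnessLib

/-!
# A vanishing-viscosity limit of suitable weak Navier–Stokes solutions is a suitable weak EULER solution
# (support item `EulerZoomLiouville.SereginZoomReduction` = stmt-NavierStokesRegularity-19834)

Route `EulerZoomLiouville` (NavierStokesRegularity), support item Z = Seregin's Euler-zoom theorem (Seregin 2026
Thm 3.1 = Seregin 2023 Prop 1.2 at `(s,l,κ) = (3,3,2)`, `f(r) = r^ρ`): the Euler-zoomed sequence solves
Navier–Stokes with viscosities `ν_k = λ_k^ρ → 0`, and its compactness limit must be shown to be a suitable weak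
solution of the EULER system, `IsSuitableWeakSolutionOn Q 0 0 u p` (Seregin 2026, (3.6)–(3.7)).  The tree's
stability theorem `isSuitableWeakSolutionOn_of_tendsto` (CKN 1982 §2; Lin 1998 Thm 2.2; Bradshaw–Tsai 2019
§4.3) is stated for a FIXED viscosity; this file is its twin for viscosities `ν_k ≥ 0`, `ν_k → 0`:

* `isSuitableWeakSolutionOn_of_tendsto_vanishingViscosity` — on an open space–time region `Q` of finite
  measure, if `(v_k, π_k)` are suitable weak solutions with viscosities `ν_k ≥ 0`, `ν_k → 0` (no force), with
  weak gradients `G_k`, `v_k ∈ L³(Q)`, `∫_Q |π_k|^{3/2} ≤ C_p`; `v_k → u` in `L³(Q)`; `π_k ⇀ p` weakly in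
  `L^{3/2}(Q)` with `∫_Q |p|^{3/2} ≤ C_p`; `u` has a weak gradient `Gu ∈ L²(Q)` and is `L^∞_t L²_x` on compact
  subsets — then `(u, p)` is a suitable weak solution of EULER on `Q` (with gradient `Gu`).  The viscous terms
  `ν_k ∫ ⟪v_k, Δψ⟫`, `ν_k ∫ |v_k|² Δφ` tend to `0`, the dissipation `2ν_k ∫ |G_k|² φ ≥ 0` is simply dropped, the
  rest passes to the limit exactly as in the fixed-viscosity proof (no weak convergence of the gradients is
  needed).

WHAT THIS IS NOT: not NS regularity, not the crux; a helper `--supports` stmt-19834. [folklore]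
-/

noncomputable section

open MeasureTheory TopologicalSpace Set Function Filter Metric
open scoped ENNReal NNReal Topology InnerProductSpace RealInnerProductSpace Laplacian

namespace Summit.NavierStokesRegularity.NavierStokesRegularity.Theorems.SereginZoomReduction

open Literature.Analysis Literature.Analysis.FluidPDE Literature.Analysis.FunctionSpaces

set_option linter.dupNamespace false

variable {E : Type*} [NormedAddCommGroup E] [InnerProductSpace ℝ E] [FiniteDimensional ℝ E]
  [MeasurableSpace E] [BorelSpace E]

/-- **A vanishing-viscosity limit of suitable weak solutions is a suitable weak Euler solution.**  Let `Q` be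
an open space–time region of finite measure and `(vₖ, πₖ)` suitable weak solutions on `Q` with viscosities
`νₖ ≥ 0`, `νₖ → 0` (no force), weak spatial gradients `Gₖ`, `vₖ ∈ L³(Q)` and `∫_Q |πₖ|^{3/2} ≤ C_p`.  Assume
`vₖ → u` in `L³(Q)`; `πₖ ⇀ p` weakly in `L^{3/2}(Q)` (pairings with `L³(Q)` converge) with
`∫_Q |p|^{3/2} ≤ C_p`; `Gu` is a weak spatial gradient of `u` on `Q` with `∫_Q |Gu|² < ∞`; and
`u ∈ L^∞_t L²_x` on compact subsets of `Q`.  Then `(u, p)` is a suitable weak solution of the Euler system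
on `Q` (`ν = 0`): divergence condition and momentum equation pass to the limit term by term, the viscous term
`νₖ ∫ ⟪vₖ, Δψ⟫ → 0`; in the local energy inequality the dissipation `2νₖ ∫ |Gₖ|² φ ≥ 0` is dropped, the viscous
weight `νₖ ∫ |vₖ|² Δφ → 0` and the remaining right-hand side converges (`tendsto_setIntegral_lei_rhs` at
`ν = 0`), so `0 ≤ ∫ (|u|² ∂ₜφ + (|u|² + 2p) ⟪u, ∇φ⟫)`. [folklore] -/
theorem isSuitableWeakSolutionOn_of_tendsto_vanishingViscosity {Q : Opens (ℝ × E)}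
    (hQ : volume (Q : Set (ℝ × E)) ≠ ∞) {ν : ℕ → ℝ} (hν : ∀ k, 0 ≤ ν k)
    (hνlim : Tendsto ν atTop (𝓝 0))
    {v : ℕ → ℝ → E → E} {π : ℕ → ℝ → E → ℝ} {G : ℕ → ℝ → E → E →L[ℝ] E}
    {u : ℝ → E → E} {p : ℝ → E → ℝ} {Gu : ℝ → E → E →L[ℝ] E} {Cp : ℝ≥0∞} (hCp : Cp ≠ ∞)
    (hsol : ∀ k, IsSuitableWeakSolutionOn Q (ν k) 0 (v k) (π k))
    (hG : ∀ k, HasWeakSpatialGradientOn Q (v k) (G k))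
    (hv3 : ∀ k, MemLp (uncurry (v k)) 3 (volume.restrict (Q : Set (ℝ × E))))
    (hπb : ∀ k, ∫⁻ z in (Q : Set (ℝ × E)), ‖π k z.1 z.2‖ₑ ^ (3 / 2 : ℝ) ≤ Cp)
    (hu3 : MemLp (uncurry u) 3 (volume.restrict (Q : Set (ℝ × E))))
    (hpm : AEStronglyMeasurable (uncurry p) (volume.restrict (Q : Set (ℝ × E))))
    (hpb : ∫⁻ z in (Q : Set (ℝ × E)), ‖p z.1 z.2‖ₑ ^ (3 / 2 : ℝ) ≤ Cp)
    (hGu : HasWeakSpatialGradientOn Q u Gu)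
    (hGu2 : ∫⁻ z in (Q : Set (ℝ × E)), ENNReal.ofReal (frobeniusNormSq (Gu z.1 z.2)) < ∞)
    (huE : ∀ K ⊆ (Q : Set (ℝ × E)), IsCompact K → ∃ C : ℝ≥0, ∀ᵐ t : ℝ,
      ∫⁻ x, K.indicator (fun z : ℝ × E => ‖u z.1 z.2‖ₑ ^ 2) (t, x) ≤ C)
    (hconv : Tendsto (fun k => eLpNorm (uncurry (v k) - uncurry u) 3
      (volume.restrict (Q : Set (ℝ × E)))) atTop (𝓝 0))
    (hπw : ∀ g : ℝ × E → ℝ, MemLp g 3 (volume.restrict (Q : Set (ℝ × E))) →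
      Tendsto (fun k => ∫ z in (Q : Set (ℝ × E)), π k z.1 z.2 * g z) atTop
        (𝓝 (∫ z in (Q : Set (ℝ × E)), p z.1 z.2 * g z))) :
    IsSuitableWeakSolutionOn Q 0 0 u p := by
  set S : Set (ℝ × E) := (Q : Set (ℝ × E)) with hS
  have hSm : MeasurableSet S := Q.isOpen.measurableSet
  set μQ : Measure (ℝ × E) := volume.restrict S with hμQ
  haveI : IsFiniteMeasure μQ := ⟨by rw [hμQ, Measure.restrict_apply_univ]; exact hQ.lt_top⟩
  have h13 : (1 : ℝ≥0∞) ≤ 3 := by norm_num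
  have h23 : (2 : ℝ≥0∞) ≤ 3 := by norm_num
  have h132 : (1 : ℝ≥0∞) ≤ 3 / 2 := FunctionSpaces.ennreal_one_le_three_halves
  -- memberships
  have hv2 : ∀ k, MemLp (uncurry (v k)) 2 μQ := fun k => (hv3 k).mono_exponent h23
  have hu2 : MemLp (uncurry u) 2 μQ := hu3.mono_exponent h23
  have hu1 : Integrable (uncurry u) μQ := hu3.integrable h13
  have hconv2 : Tendsto (fun k => eLpNorm (uncurry (v k) - uncurry u) 2 μQ) atTop (𝓝 0) :=
    tendsto_eLpNorm_two_of_three (fun k => (hv3 k).1.sub hu3.1) hconv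
  have hπm : ∀ k, AEStronglyMeasurable (uncurry (π k)) μQ := fun k =>
    (hsol k).distributional.2.2.1.aestronglyMeasurable
  have hπmem : ∀ k, MemLp (uncurry (π k)) (3 / 2) μQ ∧
      eLpNorm (uncurry (π k)) (3 / 2) μQ ≤ Cp ^ (1 / (3 / 2 : ℝ)) := fun k =>
    memLp_threeHalves_of_lintegral_le (hπm k) hCp (hπb k)
  have hpmem := memLp_threeHalves_of_lintegral_le hpm hCp hpb
  have hMt : Cp ^ (1 / (3 / 2 : ℝ)) ≠ ⊤ := ENNReal.rpow_ne_top_of_nonneg (by norm_num) hCp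
  have hp1 : Integrable (uncurry p) μQ := hpmem.1.integrable h132
  have hπ1 : ∀ k, Integrable (uncurry (π k)) μQ := fun k => (hπmem k).1.integrable h132
  ------------------------------------------------------------------
  -- (1) the distributional Euler equations
  ------------------------------------------------------------------
  have hdist : IsDistributionalNSSolutionOn Q 0 0 u p := by
    refine ⟨IntegrableOn.locallyIntegrableOn hu1, ?_, IntegrableOn.locallyIntegrableOn hp1,
      fun θ hθ => ?_, fun ψ hψ => ?_⟩
    · exact IntegrableOn.locallyIntegrableOn ((memLp_two_iff_integrable_sq_norm hu2.1).1 hu2)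
    · -- divergence free
      obtain ⟨C, hC0, -, -, hgC, -⟩ := hθ.exists_scalar_weights_bound
      have hw : AEStronglyMeasurable (fun z : ℝ × E => gradient (θ z.1) z.2) μQ :=
        hθ.continuous_slice_gradient.aestronglyMeasurable
      have hlim : Tendsto (fun k => ∫ z, ⟪uncurry (v k) z, gradient (θ z.1) z.2⟫ ∂μQ) atTop
          (𝓝 (∫ z, ⟪uncurry u z, gradient (θ z.1) z.2⟫ ∂μQ)) :=
        tendsto_integral_inner_of_tendsto_eLpNorm_two_bdd hv2 hu2 hconv2 hw hC0 hgC
      have h0 : ∀ k, ∫ z, ⟪uncurry (v k) z, gradient (θ z.1) z.2⟫ ∂μQ = 0 := fun k =>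
        (hsol k).distributional.2.2.2.1 θ hθ
      simp only [h0] at hlim
      exact (tendsto_nhds_unique tendsto_const_nhds hlim).symm
    · -- the momentum equation
      obtain ⟨C, hC0, htC, hDC, hΔC, hdivC⟩ := hψ.exists_weights_bound
      have htm : AEStronglyMeasurable (fun z : ℝ × E => timeDeriv ψ z.1 z.2) μQ :=
        hψ.continuous_timeDeriv.aestronglyMeasurable
      have hDm : AEStronglyMeasurable (fun z : ℝ × E => fderiv ℝ (ψ z.1) z.2) μQ :=
        hψ.continuous_fderiv_slice.aestronglyMeasurable
      have hΔm : AEStronglyMeasurable (fun z : ℝ × E => Δ (ψ z.1) z.2) μQ :=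
        hψ.continuous_laplacian_slice.aestronglyMeasurable
      have hdivm : AEStronglyMeasurable (fun z : ℝ × E => VectorCalculus.divergence (ψ z.1) z.2) μQ :=
        hψ.continuous_divergence_slice.aestronglyMeasurable
      have hdiv3 : MemLp (fun z : ℝ × E => VectorCalculus.divergence (ψ z.1) z.2) 3 μQ :=
        (memLp_top_of_bound hdivm C (Eventually.of_forall hdivC)).mono_exponent le_top
      have happ : Continuous (uncurry fun (T : E →L[ℝ] E) (x : E) => T x) :=
        isBoundedBilinearMap_apply.continuous
      -- splitting of the tested integrand (viscosity `η`)
      have hsplit : ∀ (η : ℝ) {w : ℝ → E → E} {q : ℝ → E → ℝ}, MemLp (uncurry w) 2 μQ →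
          Integrable (uncurry q) μQ →
          ∫ z, (⟪w z.1 z.2, timeDeriv ψ z.1 z.2⟫ + ⟪w z.1 z.2, convect (w z.1) (ψ z.1) z.2⟫ +
            η * ⟪w z.1 z.2, Δ (ψ z.1) z.2⟫ + q z.1 z.2 * VectorCalculus.divergence (ψ z.1) z.2 +
            ⟪(0 : ℝ → E → E) z.1 z.2, ψ z.1 z.2⟫) ∂μQ =
          ((∫ z, ⟪uncurry w z, timeDeriv ψ z.1 z.2⟫ ∂μQ) +
            ∫ z, ⟪uncurry w z, fderiv ℝ (ψ z.1) z.2 (uncurry w z)⟫ ∂μQ) +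
          (η * ∫ z, ⟪uncurry w z, Δ (ψ z.1) z.2⟫ ∂μQ +
            ∫ z, uncurry q z * VectorCalculus.divergence (ψ z.1) z.2 ∂μQ) := by
        intro η w q hw hq
        have hw1 : Integrable (uncurry w) μQ := hw.integrable one_le_two
        have hbd : ∀ {g : ℝ × E → E}, AEStronglyMeasurable g μQ → (∀ z, ‖g z‖ ≤ C) →
            Integrable (fun z => ⟪uncurry w z, g z⟫) μQ := fun {g} hg hgC => by
          refine (hw1.norm.mul_const C).mono' (hw.1.inner hg) (Eventually.of_forall fun z => ?_)
          exact (norm_inner_le_norm _ _).trans (mul_le_mul_of_nonneg_left (hgC z) (norm_nonneg _))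
        have i1 := hbd htm htC
        have i2 : Integrable (fun z => ⟪uncurry w z, fderiv ℝ (ψ z.1) z.2 (uncurry w z)⟫) μQ := by
          have hm : AEStronglyMeasurable (fun z => fderiv ℝ (ψ z.1) z.2 (uncurry w z)) μQ :=
            happ.comp_aestronglyMeasurable₂ hDm hw.1
          have h2 : Integrable (fun z => ‖uncurry w z‖ ^ 2) μQ :=
            (memLp_two_iff_integrable_sq_norm hw.1).1 hw
          refine (h2.const_mul C).mono' (hw.1.inner hm) (Eventually.of_forall fun z => ?_)
          calc ‖⟪uncurry w z, fderiv ℝ (ψ z.1) z.2 (uncurry w z)⟫‖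
              ≤ ‖uncurry w z‖ * ‖fderiv ℝ (ψ z.1) z.2 (uncurry w z)‖ := norm_inner_le_norm _ _
            _ ≤ ‖uncurry w z‖ * (C * ‖uncurry w z‖) := by
                gcongr
                exact (ContinuousLinearMap.le_opNorm _ _).trans
                  (mul_le_mul_of_nonneg_right (hDC z) (norm_nonneg _))
            _ = C * ‖uncurry w z‖ ^ 2 := by ring
        have i3 : Integrable (fun z => η * ⟪uncurry w z, Δ (ψ z.1) z.2⟫) μQ := (hbd hΔm hΔC).const_mul η
        have i4 : Integrable (fun z => uncurry q z * VectorCalculus.divergence (ψ z.1) z.2) μQ :=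
          (hq.bdd_mul hdivm (Eventually.of_forall hdivC)).congr
            (Eventually.of_forall fun z => mul_comm _ _)
        have i12 : Integrable (fun z => ⟪uncurry w z, timeDeriv ψ z.1 z.2⟫ +
            ⟪uncurry w z, fderiv ℝ (ψ z.1) z.2 (uncurry w z)⟫) μQ := i1.add i2
        have i34 : Integrable (fun z => η * ⟪uncurry w z, Δ (ψ z.1) z.2⟫ +
            uncurry q z * VectorCalculus.divergence (ψ z.1) z.2) μQ := i3.add i4
        have e1 := integral_add i1 i2
        have e2 := integral_add i3 i4
        have e12 := integral_add i12 i34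
        have e3 := integral_const_mul (μ := μQ) η (fun z : ℝ × E => ⟪uncurry w z, Δ (ψ z.1) z.2⟫)
        rw [← e3, ← e1, ← e2, ← e12]
        refine integral_congr_ae (Eventually.of_forall fun z => ?_)
        simp only [convect, uncurry, Pi.zero_apply, inner_zero_left, add_zero]
        ring
      -- the limits of the four pieces
      have hl1 : Tendsto (fun k => ∫ z, ⟪uncurry (v k) z, timeDeriv ψ z.1 z.2⟫ ∂μQ) atTop
          (𝓝 (∫ z, ⟪uncurry u z, timeDeriv ψ z.1 z.2⟫ ∂μQ)) :=
        tendsto_integral_inner_of_tendsto_eLpNorm_two_bdd hv2 hu2 hconv2 htm hC0 htC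
      have hl2 : Tendsto (fun k => ∫ z, ⟪uncurry (v k) z, fderiv ℝ (ψ z.1) z.2 (uncurry (v k) z)⟫ ∂μQ)
          atTop (𝓝 (∫ z, ⟪uncurry u z, fderiv ℝ (ψ z.1) z.2 (uncurry u z)⟫ ∂μQ)) :=
        tendsto_integral_inner_clm_apply_of_tendsto_eLpNorm hv2 hu2 hconv2 hDm hC0 hDC
      have hl3 : Tendsto (fun k => ν k * ∫ z, ⟪uncurry (v k) z, Δ (ψ z.1) z.2⟫ ∂μQ) atTop
          (𝓝 (0 * ∫ z, ⟪uncurry u z, Δ (ψ z.1) z.2⟫ ∂μQ)) :=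
        hνlim.mul (tendsto_integral_inner_of_tendsto_eLpNorm_two_bdd hv2 hu2 hconv2 hΔm hC0 hΔC)
      have hl4 : Tendsto (fun k => ∫ z, uncurry (π k) z * VectorCalculus.divergence (ψ z.1) z.2 ∂μQ)
          atTop (𝓝 (∫ z, uncurry p z * VectorCalculus.divergence (ψ z.1) z.2 ∂μQ)) :=
        hπw _ hdiv3
      have hlim := (hl1.add hl2).add (hl3.add hl4)
      have hk : ∀ k, ((∫ z, ⟪uncurry (v k) z, timeDeriv ψ z.1 z.2⟫ ∂μQ) +
          ∫ z, ⟪uncurry (v k) z, fderiv ℝ (ψ z.1) z.2 (uncurry (v k) z)⟫ ∂μQ) +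
          (ν k * ∫ z, ⟪uncurry (v k) z, Δ (ψ z.1) z.2⟫ ∂μQ +
            ∫ z, uncurry (π k) z * VectorCalculus.divergence (ψ z.1) z.2 ∂μQ) = 0 := fun k => by
        rw [← hsplit (ν k) (hv2 k) (hπ1 k)]
        exact (hsol k).distributional.2.2.2.2 ψ hψ
      simp only [hk] at hlim
      have h := tendsto_nhds_unique tendsto_const_nhds hlim
      rw [hsplit 0 hu2 hp1]
      exact h.symm
  ------------------------------------------------------------------
  -- (2)–(4) the classes and the local energy inequality
  ------------------------------------------------------------------
  refine
    { distributional := hdist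
      energyClass := huE
      pressure := fun K hK _ => (lintegral_mono_set hK).trans_lt (hpb.trans_lt hCp.lt_top)
      localEnergy := ⟨Gu, hGu, fun K hK _ => (lintegral_mono_set hK).trans_lt hGu2, ?_⟩ }
  intro φ hφ hφ0
  obtain ⟨C, hC0, hφC, -, -, hΔC⟩ := hφ.exists_scalar_weights_bound
  -- the local energy inequalities of the `vₖ`, in set-integral form with the gradients `Gₖ`
  have hk := fun k => (hsol k).setIntegral_localEnergy hQ (hG k) (hv3 k) (hπmem k).1 hφ hφ0
  -- convergence of the inviscid right-hand sides
  have hR := tendsto_setIntegral_lei_rhs (μ := μQ) 0 hφ hMt hv3 hu3 hconv hπm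
    (fun k => (hπmem k).2) hpmem.1 hπw
  -- the viscous weights `νₖ ∫ Δφ |vₖ|²` tend to `0`
  have hΔm : AEStronglyMeasurable (fun z : ℝ × E => Δ (φ z.1) z.2) μQ :=
    hφ.continuous_laplacian_slice.aestronglyMeasurable
  have hV := FunctionSpaces.tendsto_integral_mul_norm_sq (μ := μQ) (fun k => (hv3 k).1)
    (hu3.mono_exponent h23) (tendsto_eLpNorm_two_of_three (fun k => (hv3 k).1.sub hu3.1) hconv) hΔm
    hC0 hΔC
  have hV0 : Tendsto (fun k => ν k * ∫ z, Δ (φ z.1) z.2 * ‖v k z.1 z.2‖ ^ 2 ∂μQ) atTop (𝓝 0) := by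
    have h := hνlim.mul hV
    rw [zero_mul] at h
    exact h
  -- the right-hand sides at viscosity `νₖ` split as inviscid part + viscous weight
  have hsplitR : ∀ k, ∫ z, (‖v k z.1 z.2‖ ^ 2 * (timeDeriv φ z.1 z.2 + ν k * Δ (φ z.1) z.2) +
      (‖v k z.1 z.2‖ ^ 2 + 2 * π k z.1 z.2) * ⟪v k z.1 z.2, gradient (φ z.1) z.2⟫) ∂μQ =
      (∫ z, (‖v k z.1 z.2‖ ^ 2 * (timeDeriv φ z.1 z.2 + 0 * Δ (φ z.1) z.2) +
        (‖v k z.1 z.2‖ ^ 2 + 2 * π k z.1 z.2) * ⟪v k z.1 z.2, gradient (φ z.1) z.2⟫) ∂μQ) +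
      ν k * ∫ z, Δ (φ z.1) z.2 * ‖v k z.1 z.2‖ ^ 2 ∂μQ := by
    intro k
    obtain ⟨iA, iB, iC⟩ := integrable_lei_pieces (μ := μQ) 0 hφ (hv3 k) (hπmem k).1
    have h2 : Integrable (fun z : ℝ × E => ‖v k z.1 z.2‖ ^ 2) μQ :=
      (memLp_two_iff_integrable_sq_norm (hv2 k).1).1 (hv2 k)
    have iD : Integrable (fun z : ℝ × E => Δ (φ z.1) z.2 * ‖v k z.1 z.2‖ ^ 2) μQ := by
      refine (h2.const_mul C).mono' (hΔm.mul ((hv2 k).1.norm.pow 2)) (Eventually.of_forall fun z => ?_)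
      rw [norm_mul, Real.norm_of_nonneg (by positivity : (0 : ℝ) ≤ ‖v k z.1 z.2‖ ^ 2)]
      exact mul_le_mul_of_nonneg_right (hΔC z) (by positivity)
    have i0 : Integrable (fun z : ℝ × E => ‖v k z.1 z.2‖ ^ 2 * (timeDeriv φ z.1 z.2 + 0 * Δ (φ z.1) z.2) +
        (‖v k z.1 z.2‖ ^ 2 + 2 * π k z.1 z.2) * ⟪v k z.1 z.2, gradient (φ z.1) z.2⟫) μQ := by
      have h := iA.add (iB.add (iC.const_mul 2))
      refine h.congr (Eventually.of_forall fun z => ?_)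
      simp only [Pi.add_apply]
      ring
    rw [← integral_const_mul, ← integral_add i0 (iD.const_mul _)]
    refine integral_congr_ae (Eventually.of_forall fun z => ?_)
    ring
  -- pass to set integrals in the goal
  have hGum : AEStronglyMeasurable (uncurry Gu) μQ := hGu.locallyIntegrableOn_grad.aestronglyMeasurable
  have hφm : AEStronglyMeasurable (uncurry φ) μQ := hφ.contDiff.continuous.aestronglyMeasurable
  have hfrobm : AEStronglyMeasurable (fun z : ℝ × E => frobeniusNormSq (Gu z.1 z.2)) μQ :=
    LerayHopfProofs.continuous_frobeniusNormSq.comp_aestronglyMeasurable hGum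
  have hIGu : IntegrableOn (fun z : ℝ × E => frobeniusNormSq (Gu z.1 z.2) * φ z.1 z.2) S volume := by
    have hf : Integrable (fun z : ℝ × E => frobeniusNormSq (Gu z.1 z.2)) μQ := by
      refine ⟨hfrobm, ?_⟩
      rw [hasFiniteIntegral_iff_enorm]
      refine lt_of_le_of_lt (lintegral_mono fun z => ?_) hGu2
      rw [Real.enorm_eq_ofReal (frobeniusNormSq_nonneg _)]
    refine (hf.mul_const C).mono' (hfrobm.mul hφm) (Eventually.of_forall fun z => ?_)
    rw [norm_mul, Real.norm_of_nonneg (frobeniusNormSq_nonneg _)]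
    exact mul_le_mul_of_nonneg_left (hφC z) (frobeniusNormSq_nonneg _)
  rw [integral_integral_frobeniusNormSq_mul_eq hφ hIGu, integral_integral_lei_rhs_eq hQ 0 hu3 hpmem.1 hφ]
  rw [mul_zero, zero_mul]
  -- nonnegativity of the right-hand sides at viscosity `νₖ`, and the limit
  have hRk0 : ∀ k, 0 ≤ (∫ z, (‖v k z.1 z.2‖ ^ 2 * (timeDeriv φ z.1 z.2 + 0 * Δ (φ z.1) z.2) +
      (‖v k z.1 z.2‖ ^ 2 + 2 * π k z.1 z.2) * ⟪v k z.1 z.2, gradient (φ z.1) z.2⟫) ∂μQ) +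
      ν k * ∫ z, Δ (φ z.1) z.2 * ‖v k z.1 z.2‖ ^ 2 ∂μQ := fun k => by
    rw [← hsplitR k]
    refine le_trans ?_ (hk k).2
    exact mul_nonneg (mul_nonneg zero_le_two (hν k))
      (integral_nonneg fun z => mul_nonneg (frobeniusNormSq_nonneg _) (hφ0 _ _))
  have hlim := hR.add hV0
  rw [add_zero] at hlim
  exact ge_of_tendsto' hlim hRk0

end Summit.NavierStokesRegularity.NavierStokesRegularity.Theorems.SereginZoomReduction
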